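import Mathlib
import Summits.ResolutionOfSingularities.ResolutionOfSingularities.Theorems.EquisingularLiftDefs
import Summits.ResolutionOfSingularities.ResolutionOfSingularities.Theorems.EquisingularLiftEquisingularLiftSectionComapPoint
import Literature.AlgebraicGeometry.Motives.ZariskiChowCover
import Literature.AlgebraicGeometry.Motives.GoodReductionSpecialFibreProofs
import Literature.AlgebraicGeometry.Resolution.RegularLocalRingsProofs
import Literature.AlgebraicGeometry.Resolution.ResolutionOfSingularities
import HarnessLib

/-!
# A regular proper scheme over a DVR with irreducible special fibre and a point of good reduction is integral, flat and surjective over the base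

Helper `isIntegral_and_flat_of_goodAt` (sub-goal L0 of the registered stub
`stub_resolveOnePoint_dimOne`) of the line `strata-split` for the crux `EquisingularLift`
(stmt-ResolutionOfSingularities-15660).

Let `O` be a discrete valuation ring with closed point `s` and uniformizer `ϖ`, and let
`r : X → Spec O` be proper with `X` regular and locally Noetherian, with irreducible special fibre
`r ⁻¹' {s}`, and with a point `x` over `s` at which the ambient has good reduction (`GoodAt r x`:
`𝒪_{X,x}` regular and the germ of `r♯(ϖ)` outside `𝔪_x²`). Then `X` is integral and `r` is flat and
surjective:

* the local rings of `X` are regular, hence domains (Matsumura, Thm. 14.3), so `X` is reduced;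
* `X` is connected: a non-empty closed subset of `X` has closed image in `Spec O` (`r` is
  universally closed), which therefore contains the closed point `s`; so both halves of a clopen
  decomposition of `X` would meet the irreducible (hence connected) special fibre;
* a connected locally Noetherian scheme with integral local rings is irreducible
  (Görtz–Wedhorn I, Exercise 3.16), so `X` is integral;
* `r` is surjective: `Spec O = {η, s}`, `s = r x`, and if `η` were not in the image then `r` would
  factor set-theoretically through `{s}`, so the global section `r♯(ϖ)` of the reduced scheme `X`
  would vanish (its basic open is empty), contradicting `germ_x (r♯ ϖ) ∉ 𝔪_x²`;
* an integral scheme surjective onto the spectrum of a principal ideal domain is flat over it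
  (Hartshorne III, Prop. 9.7).

References: R. Hartshorne, *Algebraic Geometry*, Springer 1977, III Prop. 9.7;
U. Görtz, T. Wedhorn, *Algebraic Geometry I* (2nd ed., 2020), Exercise 3.16;
H. Matsumura, *Commutative Ring Theory*, CUP 1986, Thm. 14.3;
Q. Liu, *Algebraic Geometry and Arithmetic Curves*, OUP 2002, Ch. 4, Prop. 3.8 and Ch. 8, §3.1.
-/

set_option linter.dupNamespace false -- mandated namespace of this single-conjunct summit
set_option linter.overlappingInstances false -- the registered signature carries both [IsDomain O] and [IsDiscreteValuationRing O] (Mathlib's class takes the former as a parameter)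

namespace Summit.ResolutionOfSingularities.ResolutionOfSingularities.Cruxes.EquisingularLift.StrataSplit

open CategoryTheory CategoryTheory.Limits AlgebraicGeometry TopologicalSpace
open IsLocalRing Literature.AlgebraicGeometry.Resolution
open Summit.ResolutionOfSingularities.ResolutionOfSingularities.Theses.EquisingularLift.Split

/-- A non-empty closed subset of a scheme universally closed over the spectrum of a local ring `O`
meets the fibre over the closed point: its image is closed, non-empty and stable under
specialization, and every point of `Spec O` specializes to the closed point. [folklore] -/
theorem inter_preimage_closedPoint_nonempty_of_isClosed {O : Type} [CommRing O] [IsLocalRing O]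
    {X : Scheme.{0}} (r : X ⟶ Spec (.of O)) [UniversallyClosed r] {C : Set X} (hC : IsClosed C)
    (hne : C.Nonempty) : (C ∩ r ⁻¹' {closedPoint O}).Nonempty := by
  obtain ⟨c, hc⟩ := hne
  obtain ⟨c', hc', h⟩ : closedPoint O ∈ r '' C :=
    (specializes_closedPoint (r c)).mem_closed (r.isClosedMap C hC) ⟨c, hc, rfl⟩
  exact ⟨c', hc', h⟩

/-- A non-empty scheme universally closed over the spectrum of a local ring whose fibre over the
closed point is irreducible is connected: both halves of a clopen decomposition would meet the
(connected) special fibre. [folklore] -/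
theorem connectedSpace_of_isIrreducible_preimage_closedPoint {O : Type} [CommRing O]
    [IsLocalRing O] {X : Scheme.{0}} (r : X ⟶ Spec (.of O)) [UniversallyClosed r]
    (hirr : IsIrreducible (r ⁻¹' {closedPoint O})) [Nonempty X] : ConnectedSpace X := by
  refine connectedSpace_iff_clopen.mpr ⟨‹_›, fun U hU => ?_⟩
  by_contra h
  push Not at h
  obtain ⟨hU0, hU1⟩ := h
  obtain ⟨a, haU, haF⟩ := inter_preimage_closedPoint_nonempty_of_isClosed r hU.isClosed hU0
  obtain ⟨b, hbU, hbF⟩ := inter_preimage_closedPoint_nonempty_of_isClosed r hU.compl.isClosed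
    (Set.nonempty_compl.mpr hU1)
  obtain ⟨c, -, hcU, hcU'⟩ := hirr.isConnected.isPreconnected U Uᶜ hU.isOpen hU.compl.isOpen
    (by simp) ⟨a, haF, haU⟩ ⟨b, hbF, hbU⟩
  exact hcU' hcU

/-- **A regular proper `O`-scheme (`O` a discrete valuation ring) with irreducible special fibre
and one point of good reduction in it is integral, flat and surjective over `Spec O`.** Regular
local rings are domains, so `X` is reduced with integral local rings; `X` is connected because every
non-empty closed subset meets the irreducible special fibre (`r` is closed); hence `X` is
irreducible (Görtz–Wedhorn I, Exercise 3.16) and integral. If the generic point of `Spec O` were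
not in the image, `r♯(ϖ)` would vanish on the reduced `X`, contradicting `germ_x (r♯ ϖ) ∉ 𝔪_x²`;
so `r` is surjective, and an integral scheme surjective over a principal ideal domain is flat
(Hartshorne III, Prop. 9.7). -/
theorem isIntegral_and_flat_of_goodAt : ∀ (O : Type) [CommRing O] [IsDomain O] [IsDiscreteValuationRing O] (X : AlgebraicGeometry.Scheme.{0}) (r : X ⟶ AlgebraicGeometry.Spec (.of O)) [AlgebraicGeometry.IsProper r], AlgebraicGeometry.IsLocallyNoetherian X → Literature.AlgebraicGeometry.Resolution.Scheme.IsRegular X → IsIrreducible (r ⁻¹' {IsLocalRing.closedPoint O}) → (∃ x : X, r x = IsLocalRing.closedPoint O ∧ Summit.ResolutionOfSingularities.ResolutionOfSingularities.Theses.EquisingularLift.Split.GoodAt r x) → AlgebraicGeometry.IsIntegral X ∧ AlgebraicGeometry.Flat r ∧ AlgebraicGeometry.Surjective r := by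
  intro O _ _ _ X r _ hNoeth hreg hirr hx
  obtain ⟨x, hx, hgood⟩ := hx
  haveI := hNoeth
  -- (1) the local rings are domains, so `X` is reduced
  have hdom : ∀ y : X, IsDomain (X.presheaf.stalk y) := fun y =>
    haveI := hreg y
    isDomain_of_isRegularLocalRing _
  haveI : IsReduced X := by
    haveI : ∀ y : X, _root_.IsReduced (X.presheaf.stalk y) := fun y => by
      haveI := hdom y
      infer_instance
    exact isReduced_of_isReduced_stalk X
  -- (2) `X` is connected (irreducible special fibre, `r` closed) and non-empty
  haveI : Nonempty X := ⟨x⟩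
  haveI : ConnectedSpace X := connectedSpace_of_isIrreducible_preimage_closedPoint r hirr
  -- (3) `X` is irreducible, hence integral
  haveI : IrreducibleSpace X :=
    Literature.AlgebraicGeometry.Motives.irreducibleSpace_of_isDomain_stalk X hdom
  haveI : IsIntegral X := isIntegral_of_irreducibleSpace_of_isReduced X
  -- (4) `r` is surjective: `Spec O = {⊥, s}`, `s = r x`, and `⊥` is hit since `r♯ ϖ ≠ 0` at `x`
  haveI : Surjective r := by
    refine ⟨fun p => ?_⟩
    rcases Ring.KrullDimLE.eq_bot_or_eq_top p with rfl | rfl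
    · by_contra hbot
      push Not at hbot
      have hrange : Set.range r ⊆ {closedPoint O} := by
        rintro _ ⟨y, rfl⟩
        rcases Ring.KrullDimLE.eq_bot_or_eq_top (r y) with h | h
        · exact absurd h (hbot y)
        · exact h
      obtain ⟨ϖ, hϖ⟩ := IsDiscreteValuationRing.exists_irreducible O
      have hϖm : ϖ ∈ maximalIdeal O := (IsLocalRing.mem_maximalIdeal ϖ).mpr hϖ.not_isUnit
      have h0 : r.appTop.hom ((Scheme.ΓSpecIso (.of O)).inv.hom ϖ) = 0 :=
        appTop_eq_zero_of_range_subset_closedPoint r hrange hϖm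
      refine hgood.2 ϖ hϖ ?_
      rw [h0, map_zero]
      exact zero_mem _
    · exact ⟨x, hx⟩
  -- (5) an integral scheme surjective over a principal ideal domain is flat
  exact ⟨inferInstance, Literature.AlgebraicGeometry.Motives.ZariskiChow.flat_of_isIntegral_of_surjective r,
    inferInstance⟩

end Summit.ResolutionOfSingularities.ResolutionOfSingularities.Cruxes.EquisingularLift.StrataSplit
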